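import Summits.QuantumFields.BalabanUV.Beta.D1BFx.AxialRibbon
import Summits.QuantumFields.BalabanUV.Beta.D1BFx.MinimiserColumnGradient

/-!
# `BalabanUV.Beta.D1BFx.DressedColumnRibbon` — road «BF-x» for binder row D1, slot (K), PART 24 letter **L-h♭, PART B (THE ONE-SHOT COLUMN): «THE bm-DRESSED COLUMN
# `colH (coDressKBmAt (toSite r) N (KInvStep d N 0)) N` IS `N^{−(d+2)}` INSIDE EVERY BLOCK; ITS PURE GAUGE `dχ_r` IS `N^{−(d+2)}` INSIDE AND `N^{−(d+1)}` ON THE FACES»** —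
# PART A's ribbon bound fed with L-h PART 1's blockwise gradient letter (`MinimiserColumnGradient.abs_colH_KInvStep_zero_diff_le`, `G = N^{−(d+3)}·C·e^{−c‖⌊u∕N⌋ − y‖∞}`):
# on a bond whose endpoints share a block, `|colH (coDressKBmAt (toSite r) N (KInvStep d N 0)) N μ y κ u| ≤ N^{−(d+2)}·2(d+1)·C_d′·e^{−c_d‖⌊u∕N⌋ − y‖∞}` (`n⁻⁵` at `d = 3`), against the
# booked `N^{−(d+1)}` on ALL bonds (`PackedColumnEnvelope.abs_colH_G0_le_block'`), which stays the letter on the block-FACE-crossing bonds — UNCONDITIONAL, d-only constants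

HONEST DEPENDENCY (cell records, verbatim): «continuum YM on T⁴ ⇐ BetaPertH ∧ nine spine estimates (0/9 proved); BetaPertH ⇐ (D1) ∧ (D4) ∧
CAP+tail; G-an2-4 gates asym, D1 and NE2/3/4.»  HONEST FRAMING (cell contract, verbatim): «discharging `BetaPertH` makes Bałaban's UV stability
UNCONDITIONAL — a real constructive-QFT result; it is NOT the continuum limit and NOT the Clay problem.»  THIS MODULE composes TREE theorems BY NAME (PART A `D1BFx/AxialRibbon`,
L-h PART 1 `D1BFx/MinimiserColumnGradient`, g53's `PackedColumnEnvelope.abs_colH_KInvStep_zero_le`, gan24's `EnvelopeBlockSum.env_le_exp_l1`); no `def`, no `def … : Prop`,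
nothing cited, NO printed hypothesis, 0 sorry.  WHAT IT IS: the one-shot instance of the OWNER d1-p2 g23's RESHAPED commission C-g23-1 = L-h♭ (F-g23-1 ∕ E-g23-1 journal
l.49298: «… the bound `|dχ_r| ≤ C·n⁻⁴` on face bonds, `≤ C·n⁻⁵` inside»; N-g23-2 l.49349).  WHAT IT IS NOT: NOT a lower bound on the face sheet (its `≍ n⁻⁴` sharpness is
Engine C's float reading D-g22-1 A-g23-1 (b), 1.49 → 1.64 in n⁻⁴ units — not a theorem here); NOT the interior GRADIENT of the dressed column (second differences of `wH` —
no engine in the tree); NOT a (K)-architecture choice ((α)∕(β)∕(β′) of N-g23-2 is an2's Q-g23-1); NOT a (1.22) row; 0 root-level binders of row D1 discharged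
(hW ∕ hR-sockets ∕ hSX-socket ∕ D1Tel ∕ D1Rep = 0); (K) NOT closed; NOT D1, NOT `BetaPertH`, NOT continuum, NOT Clay.
ABSOLUTE RULE (cell charter, verbatim): «No internally-minted statement may enter as a cited fact. Every hypothesis is either kernel-proved in
this package or a verbatim quotation of a PUBLISHED theorem with page reference. The manuscript(s) under audit are NOT citable for their own
disputed steps — they are the thing under adjudication; programme-internal (2001/route/tribunal) claims are never citable.»

CONTENT.  §3 [our object] (every `d`, `N ≥ 1`, in-block root): **`abs_colH_G0_interior_le(')`** (`≤ N^{−(d+2)}·2(d+1)·C_d′·e^{−c_d‖⌊u∕N⌋ − y‖∞}`, `C_d′ := MD163(d+1)·periodConst(κ₁₆₃(d+1), d)`,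
`c_d := κ₁₆₃(d+1)∕(d+1)`), **`abs_grad_bmGauge_G0_interior_le`** (`dχ_r` inside: `N^{−(d+2)}·(MG163 + 2(d+1)·MD163)·periodConst·e^{…}`), **`abs_grad_bmGauge_G0_le`** (`dχ_r` on every bond,
faces included: `N^{−(d+1)}·2(d+1)·C_d·(1 + e^{c_d})·e^{…}`).  §4 [our object] `d = 3`, `n = m + 1`, any in-block root `r ∈ box 4 n` (e.g. the road's `ctrOff 4 n`):
**`abs_colH_G₀_road_interior_le`**: inside a block `|colH (coDressKBmAt (toSite r) n (KInvStep 3 n 0)) n μ y κ u| ≤ (n⁵)⁻¹·(8·C₄′·e^{κ′})·e^{−(κ′∕(4n))·|u − n•y|₁}`, `C₄′ := MD163 4·periodConst (kappa163 4) 3`,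
`κ′ := kappa163 4∕4` — THE LOCATED INTERIOR COUNT `n⁻⁵`, UNCONDITIONAL.  Unit `b2b-balaban-beta-d1-formalise-leaf-01` (gen 29), road «BF-x»; COMMISSION C-g23-1 RESHAPED; INTENT «L-h♭
PART B» (journal).  Not in print; our bookkeeping.  No existing file touched.
-/

noncomputable section

namespace Summit.QuantumFields.BalabanUV.Beta.D1BFx.DressedColumnRibbon

open Finset
open scoped BigOperators
open Literature.MathematicalPhysics.QuantumFieldTheory
open Literature.MathematicalPhysics.QuantumFieldTheory.LatticeForm (quo)
open Literature.MathematicalPhysics.QuantumFieldTheory.Balaban1983to89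
open Literature.MathematicalPhysics.QuantumFieldTheory.Balaban1983to89.Beta
open B12Sec2to5 (l1 l1_nonneg)
open B4ContourShift (supNorm)
open B4TorusKernel (periodConst)
open B5Hk163Strip (kappa163 kappa163_pos)
open B5Hk163Decay (MG163)
open B5Hk163TorusHolderDecay (MD163)
open ExpKernelCalculus (MKer)
open AffineAveraging (Form0 Form1 Site box toSite unitVec)
open AveragingContours (blk)
open AveragingContoursRooted (treeGaugeAt)
open OneStepResolventKernel (Fib)
open OneStepKernelFamily (colH KInvStep)
open Summit.QuantumFields.BalabanUV.Beta.AxialDressingRooted (coDressKBmAt)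
open Summit.QuantumFields.BalabanUV.Beta.AxialProjectorBlockMean (bmGaugeAt)
open Summit.QuantumFields.BalabanUV.Beta.GAN24.EnvelopeBlockSum (env_le_exp_l1)
open Summit.QuantumFields.BalabanUV.Beta.D1BFx.PackedColumnEnvelope (abs_colH_KInvStep_zero_le)
open Summit.QuantumFields.BalabanUV.Beta.D1BFx.MinimiserColumnGradient (abs_colH_KInvStep_zero_diff_le)
open Summit.QuantumFields.BalabanUV.Beta.D1BFx.AxialRibbon (abs_colH_coDressKBmAt_interior_le abs_grad_bmGaugeAt_interior_le abs_grad_bmGaugeAt_le)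

/-! ## §3 The road's M-side pack `G₀ = coDressKBmAt (toSite r) N (KInvStep d N 0)`: interior `N^{−(d+2)}`, pure gauge `N^{−(d+2)}` inside ∕ `N^{−(d+1)}` on faces -/

section OneShot

variable {d : ℕ}

/-- [our object] **THE INTERIOR ENTRY OF THE DRESSED ONE-SHOT COLUMN IS `N^{−(d+2)}`** (every `d`, `N ≥ 1`, in-block root, UNCONDITIONAL): on a bond `(κ, u)` inside a block,
`|colH (coDressKBmAt (toSite r) N (KInvStep d N 0)) N μ y κ u| ≤ ((d+1)·N)·(2·N^{−(d+3)}·C_d′)·e^{−c_d‖⌊u∕N⌋ − y‖∞}`, `C_d′ := MD163(d+1)·periodConst(κ₁₆₃(d+1), d)`,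
`c_d := κ₁₆₃(d+1)∕(d+1)` — L-h PART 1's blockwise gradient letter fed to §2. -/
theorem abs_colH_G0_interior_le {N : ℕ} [NeZero N] (hN : 1 ≤ N) {r : Fin (d + 1) → ℕ} (hr : r ∈ box (d + 1) N) (μ : Fin (d + 1)) (y : Site (d + 1))
    (κ : Fin (d + 1)) (u : Site (d + 1)) (hblk : blk N (u + unitVec κ) = blk N u) :
    |colH (coDressKBmAt (toSite r) N (KInvStep (d := d) N 0)) N μ y κ u|
      ≤ (((d : ℝ) + 1) * N) * (2 * (((N : ℝ) ^ (d + 3))⁻¹ * (MD163 (d + 1) * periodConst (kappa163 (d + 1)) d)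
          * Real.exp (-(kappa163 (d + 1) / ((d : ℝ) + 1) * supNorm (quo N u - y))))) :=
  abs_colH_coDressKBmAt_interior_le hN hr _ μ y κ u hblk fun κ' ρ' w hw => by
    have h := abs_colH_KInvStep_zero_diff_le (d := d) N hN μ y κ' w ρ'
    have hq : quo N w = blk N w := rfl
    have hq' : quo N u = blk N u := rfl
    rw [hq, hw, ← hq'] at h
    exact h

/-- [our object] the same with the powers collected: `≤ N^{−(d+2)}·(2(d+1)·C_d′)·e^{−c_d‖⌊u∕N⌋ − y‖∞}` — ONE power below the booked `N^{−(d+1)}` of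
`PackedColumnEnvelope.abs_colH_G0_le_block'` on these bonds. -/
theorem abs_colH_G0_interior_le' {N : ℕ} [NeZero N] (hN : 1 ≤ N) {r : Fin (d + 1) → ℕ} (hr : r ∈ box (d + 1) N) (μ : Fin (d + 1)) (y : Site (d + 1))
    (κ : Fin (d + 1)) (u : Site (d + 1)) (hblk : blk N (u + unitVec κ) = blk N u) :
    |colH (coDressKBmAt (toSite r) N (KInvStep (d := d) N 0)) N μ y κ u|
      ≤ ((N : ℝ) ^ (d + 2))⁻¹ * (2 * ((d : ℝ) + 1) * (MD163 (d + 1) * periodConst (kappa163 (d + 1)) d))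
          * Real.exp (-(kappa163 (d + 1) / ((d : ℝ) + 1) * supNorm (quo N u - y))) := by
  refine (abs_colH_G0_interior_le hN hr μ y κ u hblk).trans (le_of_eq ?_)
  have hN0 : (N : ℝ) ≠ 0 := by exact_mod_cast (NeZero.ne N)
  have e : ((N : ℝ) ^ (d + 3))⁻¹ * (N : ℝ) = ((N : ℝ) ^ (d + 2))⁻¹ := by
    rw [pow_succ, mul_inv, mul_assoc, inv_mul_cancel₀ hN0, mul_one]
  calc (((d : ℝ) + 1) * N) * (2 * (((N : ℝ) ^ (d + 3))⁻¹ * (MD163 (d + 1) * periodConst (kappa163 (d + 1)) d)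
          * Real.exp (-(kappa163 (d + 1) / ((d : ℝ) + 1) * supNorm (quo N u - y)))))
      = (((N : ℝ) ^ (d + 3))⁻¹ * (N : ℝ)) * (2 * ((d : ℝ) + 1) * (MD163 (d + 1) * periodConst (kappa163 (d + 1)) d))
          * Real.exp (-(kappa163 (d + 1) / ((d : ℝ) + 1) * supNorm (quo N u - y))) := by ring
    _ = _ := by rw [e]

/-- [our object] **THE PURE GAUGE `dχ_r` OF THE ONE-SHOT COLUMN INSIDE A BLOCK IS `N^{−(d+2)}`**: `|χ_r (u + e_κ) − χ_r u| ≤ N^{−(d+2)}·(MG163(d+1) + 2(d+1)·MD163(d+1))·periodConst·e^{…}`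
(column envelope `abs_colH_KInvStep_zero_le` + interior ribbon). -/
theorem abs_grad_bmGauge_G0_interior_le {N : ℕ} [NeZero N] (hN : 1 ≤ N) {r : Fin (d + 1) → ℕ} (hr : r ∈ box (d + 1) N) (μ : Fin (d + 1)) (y : Site (d + 1))
    (κ : Fin (d + 1)) (u : Site (d + 1)) (hblk : blk N (u + unitVec κ) = blk N u) :
    |bmGaugeAt (toSite r) (colH (KInvStep (d := d) N 0) N μ y) N (u + unitVec κ) - bmGaugeAt (toSite r) (colH (KInvStep (d := d) N 0) N μ y) N u|
      ≤ ((N : ℝ) ^ (d + 2))⁻¹ * ((MG163 (d + 1) + 2 * ((d : ℝ) + 1) * MD163 (d + 1)) * periodConst (kappa163 (d + 1)) d)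
          * Real.exp (-(kappa163 (d + 1) / ((d : ℝ) + 1) * supNorm (quo N u - y))) := by
  have hM := abs_colH_KInvStep_zero_le (d := d) hN μ y κ u
  have h := abs_grad_bmGaugeAt_interior_le hN hr (KInvStep (d := d) N 0) μ y κ u hblk hM (fun κ' ρ' w hw => by
    have h := abs_colH_KInvStep_zero_diff_le (d := d) N hN μ y κ' w ρ'
    have hq : quo N w = blk N w := rfl
    have hq' : quo N u = blk N u := rfl
    rw [hq, hw, ← hq'] at h
    exact h)
  refine h.trans (le_of_eq ?_)
  have hN0 : (N : ℝ) ≠ 0 := by exact_mod_cast (NeZero.ne N)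
  have e : ((N : ℝ) ^ (d + 3))⁻¹ * (N : ℝ) = ((N : ℝ) ^ (d + 2))⁻¹ := by
    rw [pow_succ, mul_inv, mul_assoc, inv_mul_cancel₀ hN0, mul_one]
  rw [← e]
  ring

/-- [our object] **THE PURE GAUGE `dχ_r` OF THE ONE-SHOT COLUMN ON EVERY BOND, FACES INCLUDED, IS `N^{−(d+1)}`**:
`|χ_r (u + e_κ) − χ_r u| ≤ N^{−(d+1)}·(2(d+1)·C_d·(1 + e^{c_d}))·e^{−c_d‖⌊u∕N⌋ − y‖∞}`, `C_d := MG163(d+1)·periodConst(κ₁₆₃(d+1), d)` — the booked face letter, nothing sharper claimed there. -/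
theorem abs_grad_bmGauge_G0_le {N : ℕ} [NeZero N] (hN : 1 ≤ N) {r : Fin (d + 1) → ℕ} (hr : r ∈ box (d + 1) N) (μ : Fin (d + 1)) (y : Site (d + 1))
    (κ : Fin (d + 1)) (u : Site (d + 1)) :
    |bmGaugeAt (toSite r) (colH (KInvStep (d := d) N 0) N μ y) N (u + unitVec κ) - bmGaugeAt (toSite r) (colH (KInvStep (d := d) N 0) N μ y) N u|
      ≤ ((N : ℝ) ^ (d + 1))⁻¹ * (2 * ((d : ℝ) + 1) * (MG163 (d + 1) * periodConst (kappa163 (d + 1)) d)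
          * (1 + Real.exp (kappa163 (d + 1) / ((d : ℝ) + 1))))
          * Real.exp (-(kappa163 (d + 1) / ((d : ℝ) + 1) * supNorm (quo N u - y))) := by
  have hN0 : (0 : ℝ) < N := by exact_mod_cast hN
  have hc : 0 ≤ kappa163 (d + 1) / ((d : ℝ) + 1) := div_nonneg (kappa163_pos (d + 1)).le (by positivity)
  have hC : 0 ≤ ((N : ℝ) ^ (d + 2))⁻¹ * (MG163 (d + 1) * periodConst (kappa163 (d + 1)) d) := by
    have h0 := (mul_nonneg_iff_of_pos_right (Real.exp_pos _)).1 ((abs_nonneg _).trans (abs_colH_KInvStep_zero_le (d := d) hN μ y κ u))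
    exact h0
  have h := abs_grad_bmGaugeAt_le hN hr (KInvStep (d := d) N 0) μ y hC hc (fun κ' w => abs_colH_KInvStep_zero_le (d := d) hN μ y κ' w) κ u
  refine h.trans (le_of_eq ?_)
  have e : ((N : ℝ) ^ (d + 2))⁻¹ * (N : ℝ) = ((N : ℝ) ^ (d + 1))⁻¹ := by
    rw [pow_succ, mul_inv, mul_assoc, inv_mul_cancel₀ hN0.ne', mul_one]
  rw [← e]
  ring

end OneShot

/-! ## §4 `d = 3`: the road's dressed column `colH (coDressKBmAt (toSite r) n (KInvStep 3 n 0)) n`, `n = m + 1`, in the road's `ℓ¹` weight -/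

section Road

/-- [our object] **L-h♭ FOR THE ROAD, INTERIOR BONDS** (`d = 3`, block side `n = m + 1`, ANY in-block root `r ∈ box 4 n` — e.g. the road's `ctrOff 4 n` —, ANY coarse bond `(μ, y)`):
on every bond `(κ, u)` with `blk n (u + e_κ) = blk n u`,
`|colH (coDressKBmAt (toSite r) n (KInvStep 3 n 0)) n μ y κ u| ≤ (n⁵)⁻¹·(8·C₄′·e^{κ′})·e^{−(κ′∕(4n))·|u − n•y|₁}`, `C₄′ := MD163 4·periodConst (kappa163 4) 3`, `κ′ := kappa163 4∕4` —
THE LOCATED INTERIOR COUNT `n⁻⁵` (the booked letter on ALL bonds: `n⁻⁴`, `PackedColumnEnvelope.abs_colH_G₀_road_le`), UNCONDITIONAL. -/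
theorem abs_colH_G₀_road_interior_le (m : ℕ) {r : Fin (3 + 1) → ℕ} (hr : r ∈ box (3 + 1) (m + 1)) (μ : Fin (3 + 1)) (y : Fin (3 + 1) → ℤ)
    (κ : Fin (3 + 1)) (u : Fin (3 + 1) → ℤ) (hblk : blk (m + 1) (u + unitVec κ) = blk (m + 1) u) :
    |colH (coDressKBmAt (toSite r) (m + 1) (KInvStep (d := 3) (m + 1) 0)) (m + 1) μ y κ u|
      ≤ ((((m + 1 : ℕ) : ℝ) ^ 5)⁻¹ * (8 * (MD163 4 * periodConst (kappa163 4) 3) * Real.exp (kappa163 4 / 4)))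
        * Real.exp (-(kappa163 4 / 4 / (4 * ((m + 1 : ℕ) : ℝ))) * l1 (u - ((m + 1 : ℕ) : ℤ) • y)) := by
  haveI : NeZero (m + 1) := ⟨Nat.succ_ne_zero m⟩
  have hn : 1 ≤ m + 1 := Nat.le_add_left 1 m
  have hn0 : (0 : ℝ) < ((m + 1 : ℕ) : ℝ) := by exact_mod_cast Nat.succ_pos m
  have h0 := abs_colH_G0_interior_le' (d := 3) (N := m + 1) hn hr μ y κ u hblk
  have e3 : ((3 : ℕ) : ℝ) + 1 = 4 := by norm_num
  have h : |colH (coDressKBmAt (toSite r) (m + 1) (KInvStep (d := 3) (m + 1) 0)) (m + 1) μ y κ u|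
      ≤ ((((m + 1 : ℕ) : ℝ)) ^ 5)⁻¹ * (2 * 4 * (MD163 4 * periodConst (kappa163 4) 3))
          * Real.exp (-(kappa163 4 / 4 * supNorm (quo (m + 1) u - y))) := by
    simp only [e3] at h0
    exact h0
  have hc : 0 ≤ kappa163 4 / 4 := div_nonneg (kappa163_pos 4).le (by norm_num)
  have hw := env_le_exp_l1 (d := 3) (L := m + 1) hn hc y u
  simp only [e3] at hw
  have hC : 0 ≤ MD163 4 * periodConst (kappa163 4) 3 := by
    -- sign read-off from L-h PART 1's letter at this `n`
    have h0 := MinimiserColumnGradient.colH_KInvStep_zero_diff_road_weight_nonneg m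
    have h1 : 0 < ((((m + 1 : ℕ) : ℝ) ^ 6)⁻¹) := inv_pos.mpr (pow_pos hn0 _)
    have h2 := (mul_nonneg_iff_of_pos_left h1).1 h0
    exact (mul_nonneg_iff_of_pos_right (Real.exp_pos _)).1 h2
  have hK : 0 ≤ ((((m + 1 : ℕ) : ℝ)) ^ 5)⁻¹ * (2 * 4 * (MD163 4 * periodConst (kappa163 4) 3)) :=
    mul_nonneg (inv_nonneg.mpr (pow_nonneg hn0.le _)) (mul_nonneg (by norm_num) hC)
  refine h.trans ?_
  calc ((((m + 1 : ℕ) : ℝ)) ^ 5)⁻¹ * (2 * 4 * (MD163 4 * periodConst (kappa163 4) 3))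
          * Real.exp (-(kappa163 4 / 4 * supNorm (quo (m + 1) u - y)))
      ≤ ((((m + 1 : ℕ) : ℝ)) ^ 5)⁻¹ * (2 * 4 * (MD163 4 * periodConst (kappa163 4) 3))
          * (Real.exp (kappa163 4 / 4) * Real.exp (-(kappa163 4 / 4 / (4 * ((m + 1 : ℕ) : ℝ))) * l1 (u - ((m + 1 : ℕ) : ℤ) • y))) :=
        mul_le_mul_of_nonneg_left hw hK
    _ = _ := by ring

end Road

end Summit.QuantumFields.BalabanUV.Beta.D1BFx.DressedColumnRibbon

end
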